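import Mathlib
import Literature.NumberTheory.Transcendental.KZLogCalculusProofs
import Literature.NumberTheory.Transcendental.KZDominatedFamilyRelations
import Literature.NumberTheory.Transcendental.KZSemialgebraicComplex
import Literature.NumberTheory.Transcendental.SemialgebraicLineDeriv
import Literature.NumberTheory.Transcendental.KZIntervalPeriodProofs
import Summits.KontsevichZagierPeriods.KontsevichZagierPeriods.Theorems.TerasomaMultiplicationBetaCancellationStubMoebiusMove

/-!
# `TateFamilyKernelCurves` (stmt-KontsevichZagierPeriods-9132), line `Sketch` — stub `stub_arcScissors`

ARC SCISSORS ON THE RATIONAL CIRCLE (lead's stub). An INTEGER combination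
`Σ_k n_k • [(0, x_k), du/(1+u²)]` of standard arcs (`x_k ∈ (0,1)` real algebraic) whose total angle
`Σ_k n_k arctan x_k` vanishes is a relation of the Kontsevich–Zagier calculus.

Proof (one-dimensional scissors congruence for the rotation group acting on its own orbit):
* the SUBTRACTION MOVE `[(0,b)] ≡ [(0,a)] + [(0,(b−a)/(1+ab))]` for `0 < a < b < 1`: cut `(0,b)` at
  `a` (rule 1a, the point `{a}` being null) and rotate `(a,b) ↦ (0,(b−a)/(1+ab))` by the Möbius move
  `u ↦ (u − a)/(1 + au)` (rule 2; the landed `BetaCancellationLine.stub_moebiusMove` with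
  `(c,s) = (1,a)/√(1+a²)`), which preserves `du/(1+u²)`; `arctan b − arctan a = arctan((b−a)/(1+ab))`;
* GREEDY MATCHING of the positive list against the negative list (both have the same total angle):
  equal heads cancel formally; unequal heads `a < b` are matched by the subtraction move, which
  shortens the pair of lists by one — induction on the total length;
* bookkeeping: `Σ n_k • [σ_k]` is the difference of the two list sums (`n = n⁺ − n⁻`), after
  replacing each given `σ_k` by a chosen representation with the same domain and integrand (rule 1b).
-/

noncomputable section

open MeasureTheory Set
open Literature.NumberTheory.Transcendental
open Literature.ModelTheory.ExponentialFields (IsSemialgebraic isSemialgebraic_univ)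
open Summit.KontsevichZagierPeriods.KontsevichZagierPeriods.BetaCancellationLine (stub_moebiusMove)

namespace Summit.KontsevichZagierPeriods.InverseLandau

/-! ## Representations of arcs -/

/-- Open intervals of `ℝ¹` with real-algebraic endpoints are `ℚ`-semialgebraic. [folklore] -/
theorem as_isSemialgebraic_Ioo {α α' : ℝ} (hα : IsAlgebraic ℚ α) (hα' : IsAlgebraic ℚ α') :
    IsSemialgebraic ℚ {x : Fin 1 → ℝ | x 0 ∈ Set.Ioo α α'} := by
  have hu : IsSemialgebraic ℚ (univ : Set (Fin 1 → ℝ)) := isSemialgebraic_univ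
  have hx : IsSemialgebraicFunOn ℚ univ (fun x : Fin 1 → ℝ => x 0) := isSemialgebraicFunOn_apply hu 0
  have h1 := ((isSemialgebraicFunOn_const_of_isAlgebraic hu hα).fun_sub hx).isSemialgebraic_sep_neg
  have h2 := (hx.fun_sub (isSemialgebraicFunOn_const_of_isAlgebraic hu hα')).isSemialgebraic_sep_neg
  convert h1.inter h2 using 1
  ext x
  simp only [mem_setOf_eq, mem_Ioo, mem_inter_iff, mem_univ, true_and, sub_neg]

/-- The arc representation `[(α, α′), du/(1+u²)]` exists for real-algebraic `α, α′`. [folklore] -/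
theorem as_exists_arcRep {α α' : ℝ} (hα : IsAlgebraic ℚ α) (hα' : IsAlgebraic ℚ α') :
    ∃ r : KZ.IntegralRep 1, r.domain = {x : Fin 1 → ℝ | x 0 ∈ Set.Ioo α α'} ∧
      r.integrand = fun x => 1 / (1 + (x 0) ^ 2) := by
  have hW := as_isSemialgebraic_Ioo hα hα'
  have hsa : IsSemialgebraicFunOn ℚ {x : Fin 1 → ℝ | x 0 ∈ Set.Ioo α α'}
      (fun x => 1 / (1 + (x 0) ^ 2)) := by
    have h := (isSemialgebraicFunOn_const_natCast hW 1).div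
      ((isSemialgebraicFunOn_const_natCast hW 1).fun_add ((isSemialgebraicFunOn_apply hW 0).fun_pow 2))
      fun x _ => by positivity
    exact h.congr fun x _ => by norm_num
  have hint : IntegrableOn (fun x : Fin 1 → ℝ => 1 / (1 + (x 0) ^ 2))
      {x : Fin 1 → ℝ | x 0 ∈ Set.Ioo α α'} := by
    have hmp := MeasureTheory.volume_preserving_funUnique (Fin 1) ℝ
    have hpre : {x : Fin 1 → ℝ | x 0 ∈ Set.Ioo α α'} =
        MeasurableEquiv.funUnique (Fin 1) ℝ ⁻¹' Ioo α α' := by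
      ext x
      simp [MeasurableEquiv.funUnique, Fin.default_eq_zero]
    rw [hpre]
    have hc : ContinuousOn (fun t : ℝ => 1 / (1 + t ^ 2)) (Icc α α') :=
      continuousOn_const.div (by fun_prop) fun t _ => by positivity
    exact (hmp.integrableOn_comp_preimage (MeasurableEquiv.measurableEmbedding _)
      (f := fun t : ℝ => 1 / (1 + t ^ 2))).mpr (hc.integrableOn_Icc.mono_set Ioo_subset_Icc_self)
  exact ⟨⟨{x : Fin 1 → ℝ | x 0 ∈ Set.Ioo α α'}, fun x => 1 / (1 + (x 0) ^ 2), hW, hsa, hint⟩, rfl, rfl⟩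

/-! ## The subtraction move -/

/-- **Subtraction move.** For real algebraic `0 ≤ a < b`, the standard arcs satisfy
`[(0,b)] − [(0,a)] − [(0,(b−a)/(1+ab))] ∈ relations`: cut `(0,b)` at `a` (rule 1a; the point `{a}`
is null) and rotate `(a,b)` onto `(0,(b−a)/(1+ab))` by the Möbius move `u ↦ (u−a)/(1+au)`, i.e.
`BetaCancellationLine.stub_moebiusMove` with `(c,s) = (1,a)/√(1+a²)`. [cite: KontsevichZagier2001, §1.2] -/
theorem as_sub_move {a b : ℝ} (ha : IsAlgebraic ℚ a) (hb : IsAlgebraic ℚ b) (ha0 : 0 ≤ a)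
    (hab : a < b) (Ia Ib Id : KZ.IntegralRep 1)
    (hIa : Ia.domain = {y | y 0 ∈ Set.Ioo 0 a} ∧ Ia.integrand = fun y => 1 / (1 + (y 0) ^ 2))
    (hIb : Ib.domain = {y | y 0 ∈ Set.Ioo 0 b} ∧ Ib.integrand = fun y => 1 / (1 + (y 0) ^ 2))
    (hId : Id.domain = {y | y 0 ∈ Set.Ioo 0 ((b - a) / (1 + a * b))} ∧
      Id.integrand = fun y => 1 / (1 + (y 0) ^ 2)) :
    KZ.of Ib - KZ.of Ia - KZ.of Id ∈ KZ.relations := by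
  classical
  obtain ⟨hIad, hIai⟩ := hIa
  obtain ⟨hIbd, hIbi⟩ := hIb
  obtain ⟨hIdd, hIdi⟩ := hId
  -- Step 1: drop the null point `{a}`
  have hE₁ : IsSemialgebraic ℚ {y : Fin 1 → ℝ | y 0 ∈ Set.Ioo 0 a} :=
    as_isSemialgebraic_Ioo isAlgebraic_zero ha
  have hE₂ : IsSemialgebraic ℚ {y : Fin 1 → ℝ | y 0 ∈ Set.Ioo a b} := as_isSemialgebraic_Ioo ha hb
  have hE : IsSemialgebraic ℚ ({y : Fin 1 → ℝ | y 0 ∈ Set.Ioo 0 a} ∪ {y | y 0 ∈ Set.Ioo a b}) :=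
    hE₁.union hE₂
  have hEsub : ({y : Fin 1 → ℝ | y 0 ∈ Set.Ioo 0 a} ∪ {y | y 0 ∈ Set.Ioo a b}) ⊆ Ib.domain := by
    rw [hIbd]
    rintro y (hy | hy)
    · exact ⟨hy.1, hy.2.trans hab⟩
    · exact ⟨ha0.trans_lt hy.1, hy.2⟩
  have hnull : volume (Ib.domain \ ({y : Fin 1 → ℝ | y 0 ∈ Set.Ioo 0 a} ∪ {y | y 0 ∈ Set.Ioo a b})) = 0 := by
    refine measure_mono_null (fun y hy => ?_) (KZ.volume_setOf_last_eq_zero (n := 0) a)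
    obtain ⟨hy1, hy2⟩ := hy
    rw [hIbd] at hy1
    simp only [mem_union, mem_setOf_eq, mem_Ioo, not_or, not_and, not_lt] at hy2
    simp only [mem_setOf_eq, Fin.last_zero]
    rcases lt_trichotomy (y 0) a with hlt | heq | hgt
    · exact absurd (hy2.1 hy1.1) (not_le.2 hlt)
    · exact heq
    · exact absurd (hy2.2 hgt) (not_le.2 hy1.2)
  set r' := Ib.restrict _ hE hEsub with hr'
  have h1 : KZ.of Ib - KZ.of r' ∈ KZ.relations :=
    KZ.IntegralRep.of_sub_of_restrict_mem_relations Ib hE hEsub hnull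
  -- Step 2: split `r'` into the `(0,a)` piece and the `(a,b)` piece
  set Q := Ib.restrict {y : Fin 1 → ℝ | y 0 ∈ Set.Ioo a b} hE₂ (fun y hy => hEsub (Or.inr hy)) with hQ
  have h2 : KZ.of r' - KZ.of Ia - KZ.of Q ∈ KZ.relations := by
    refine KZ.domainAddRel_subset_relations ⟨1, r', Ia, Q, ?_, ?_, ?_, ?_, rfl⟩
    · rw [hIad]
      rfl
    · rw [hIad]
      have : ({y : Fin 1 → ℝ | y 0 ∈ Set.Ioo 0 a} ∩ Q.domain) = ∅ := by
        ext y
        simp only [hQ, KZ.IntegralRep.domain_restrict, mem_inter_iff, mem_setOf_eq, mem_Ioo,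
          mem_empty_iff_false, iff_false, not_and, not_lt, and_imp]
        intro _ h2 h3
        exact absurd (h2.trans h3) (lt_irrefl _)
      rw [this, measure_empty]
    · intro y _
      simp only [hr', KZ.IntegralRep.integrand_restrict, hIbi, hIai]
    · intro y _
      rfl
  -- Step 3: the Möbius rotation `(a,b) ↦ (0,(b-a)/(1+ab))`
  have h3 : KZ.of Q - KZ.of Id ∈ KZ.relations := by
    have hpos : 0 < 1 + a ^ 2 := by positivity
    set w := Real.sqrt (1 + a ^ 2) with hw
    have hw0 : 0 < w := Real.sqrt_pos.2 hpos
    have hw2 : w ^ 2 = 1 + a ^ 2 := Real.sq_sqrt hpos.le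
    have hwalg : IsAlgebraic ℚ w :=
      IsAlgebraic.of_pow two_pos (by rw [hw2]; exact isAlgebraic_one.add (ha.pow 2))
    have hc : IsAlgebraic ℚ (1 / w) := by
      rw [one_div]
      exact hwalg.inv
    have hs : IsAlgebraic ℚ (a / w) := by
      rw [div_eq_mul_inv]
      exact ha.mul hwalg.inv
    have hcs : (1 / w) ^ 2 + (a / w) ^ 2 = 1 := by
      rw [div_pow, div_pow, hw2]
      field_simp
    have hden : ∀ t ∈ Set.Icc a b, 0 < a / w * t + 1 / w := fun t ht => by
      have : a / w * t + 1 / w = (a * t + 1) / w := by ring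
      rw [this]
      have : 0 ≤ a * t := mul_nonneg ha0 (ha0.trans ht.1)
      positivity
    have hM0 : (1 / w * a - a / w) / (a / w * a + 1 / w) = 0 := by
      have : 1 / w * a - a / w = 0 := by ring
      rw [this, zero_div]
    have hMb : (1 / w * b - a / w) / (a / w * b + 1 / w) = (b - a) / (1 + a * b) := by
      have hab' : 0 < 1 + a * b := by
        have : 0 ≤ a * b := mul_nonneg ha0 (ha0.trans hab.le)
        linarith
      rw [div_eq_div_iff (hden b (right_mem_Icc.2 hab.le)).ne' hab'.ne']
      field_simp
      ring
    exact stub_moebiusMove (1 / w) (a / w) 1 hc hs isAlgebraic_one hcs a b hab hden Q Id rfl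
      (fun y _ => by simp only [hQ, KZ.IntegralRep.integrand_restrict, hIbi])
      (by rw [hIdd, hM0, hMb]) (fun y _ => by simp only [hIdi])
  have e : KZ.of Ib - KZ.of Ia - KZ.of Id =
      (KZ.of Ib - KZ.of r') + (KZ.of r' - KZ.of Ia - KZ.of Q) + (KZ.of Q - KZ.of Id) := by abel
  rw [e]
  exact add_mem (add_mem h1 h2) h3

/-! ## Greedy matching of two tilings -/

/-- The angle `arctan b − arctan a` of the arc `(a,b)`, `0 ≤ a < b`, is the angle of the standard arc
`(0,(b−a)/(1+ab))` (addition theorem for `arctan`). [folklore] -/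
theorem as_arctan_sub {a b : ℝ} (ha0 : 0 ≤ a) (hb0 : 0 ≤ b) :
    Real.arctan ((b - a) / (1 + a * b)) = Real.arctan b - Real.arctan a := by
  have h : b * -a < 1 := by nlinarith [mul_nonneg ha0 hb0]
  have hadd := Real.arctan_add h
  rw [Real.arctan_neg] at hadd
  have e : (b + -a) / (1 - b * -a) = (b - a) / (1 + a * b) := by ring
  rw [← e, ← hadd]
  ring

/-- **Greedy matching.** For a family `I` of standard arc representations indexed by the real
algebraic points of `(0,1)`: two lists with the same total angle have list sums that differ by a
relation (equal heads cancel formally; unequal heads are matched by the subtraction move, which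
shortens the pair of lists — induction on the total length). [cite: KontsevichZagier2001, §1.2] -/
theorem as_list_cancel (I : {x : ℝ // IsAlgebraic ℚ x ∧ 0 < x ∧ x < 1} → KZ.IntegralRep 1)
    (hI : ∀ t, (I t).domain = {y | y 0 ∈ Set.Ioo 0 t.1} ∧
      (I t).integrand = fun y => 1 / (1 + (y 0) ^ 2)) :
    ∀ (N : ℕ) (L₁ L₂ : List {x : ℝ // IsAlgebraic ℚ x ∧ 0 < x ∧ x < 1}),
      L₁.length + L₂.length ≤ N →
      (L₁.map fun t => Real.arctan t.1).sum = (L₂.map fun t => Real.arctan t.1).sum →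
      (L₁.map fun t => KZ.of (I t)).sum - (L₂.map fun t => KZ.of (I t)).sum ∈ KZ.relations := by
  -- positivity of the angle sums
  have hpos : ∀ L : List {x : ℝ // IsAlgebraic ℚ x ∧ 0 < x ∧ x < 1},
      0 ≤ (L.map fun t => Real.arctan t.1).sum := fun L =>
    List.sum_nonneg (by
      intro θ hθ
      obtain ⟨t, -, rfl⟩ := List.mem_map.1 hθ
      exact (Real.arctan_pos.2 t.2.2.1).le)
  intro N
  induction N with
  | zero =>
    intro L₁ L₂ hlen _
    have h1 : L₁ = [] := List.eq_nil_of_length_eq_zero (by omega)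
    have h2 : L₂ = [] := List.eq_nil_of_length_eq_zero (by omega)
    subst h1 h2
    simp
  | succ N ih =>
    intro L₁ L₂ hlen hsum
    cases L₁ with
    | nil =>
      cases L₂ with
      | nil => simp
      | cons b L₂' =>
        exfalso
        simp only [List.map_nil, List.sum_nil, List.map_cons, List.sum_cons] at hsum
        have := Real.arctan_pos.2 b.2.2.1
        have := hpos L₂'
        linarith
    | cons a L₁' =>
      cases L₂ with
      | nil =>
        exfalso
        simp only [List.map_nil, List.sum_nil, List.map_cons, List.sum_cons] at hsum
        have := Real.arctan_pos.2 a.2.2.1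
        have := hpos L₁'
        linarith
      | cons b L₂' =>
        simp only [List.length_cons] at hlen
        simp only [List.map_cons, List.sum_cons] at hsum ⊢
        rcases lt_trichotomy a.1 b.1 with hlt | heq | hgt
        · -- match `a` against the head of `b`: b = a + d
          have hd0 : 0 < (b.1 - a.1) / (1 + a.1 * b.1) :=
            div_pos (sub_pos.2 hlt) (by nlinarith [a.2.2.1, b.2.2.1])
          have hd1 : (b.1 - a.1) / (1 + a.1 * b.1) < 1 := by
            rw [div_lt_one (by nlinarith [a.2.2.1, b.2.2.1])]
            nlinarith [a.2.2.1, b.2.2.1, b.2.2.2]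
          have hdalg : IsAlgebraic ℚ ((b.1 - a.1) / (1 + a.1 * b.1)) := by
            rw [div_eq_mul_inv]
            exact (b.2.1.sub a.2.1).mul (isAlgebraic_one.add (a.2.1.mul b.2.1)).inv
          set d : {x : ℝ // IsAlgebraic ℚ x ∧ 0 < x ∧ x < 1} :=
            ⟨(b.1 - a.1) / (1 + a.1 * b.1), hdalg, hd0, hd1⟩ with hd
          have hmove : KZ.of (I b) - KZ.of (I a) - KZ.of (I d) ∈ KZ.relations :=
            as_sub_move a.2.1 b.2.1 a.2.2.1.le hlt (I a) (I b) (I d) (hI a) (hI b) (hI d)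
          have hθ : Real.arctan d.1 = Real.arctan b.1 - Real.arctan a.1 :=
            as_arctan_sub a.2.2.1.le b.2.2.1.le
          have hrec := ih L₁' (d :: L₂') (by simp only [List.length_cons]; omega) (by
            simp only [List.map_cons, List.sum_cons, hθ]
            linarith)
          simp only [List.map_cons, List.sum_cons] at hrec
          have e : KZ.of (I a) + (L₁'.map fun t => KZ.of (I t)).sum -
              (KZ.of (I b) + (L₂'.map fun t => KZ.of (I t)).sum) =
              ((L₁'.map fun t => KZ.of (I t)).sum - (KZ.of (I d) + (L₂'.map fun t => KZ.of (I t)).sum)) -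
                (KZ.of (I b) - KZ.of (I a) - KZ.of (I d)) := by abel
          rw [e]
          exact sub_mem hrec hmove
        · -- equal heads cancel
          have hab : a = b := Subtype.ext heq
          subst hab
          have hrec := ih L₁' L₂' (by omega) (by linarith)
          have e : KZ.of (I a) + (L₁'.map fun t => KZ.of (I t)).sum -
              (KZ.of (I a) + (L₂'.map fun t => KZ.of (I t)).sum) =
              (L₁'.map fun t => KZ.of (I t)).sum - (L₂'.map fun t => KZ.of (I t)).sum := by abel
          rw [e]
          exact hrec
        · -- match `b` against the head of `a`: a = b + d
          have hd0 : 0 < (a.1 - b.1) / (1 + b.1 * a.1) :=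
            div_pos (sub_pos.2 hgt) (by nlinarith [a.2.2.1, b.2.2.1])
          have hd1 : (a.1 - b.1) / (1 + b.1 * a.1) < 1 := by
            rw [div_lt_one (by nlinarith [a.2.2.1, b.2.2.1])]
            nlinarith [a.2.2.1, b.2.2.1, a.2.2.2]
          have hdalg : IsAlgebraic ℚ ((a.1 - b.1) / (1 + b.1 * a.1)) := by
            rw [div_eq_mul_inv]
            exact (a.2.1.sub b.2.1).mul (isAlgebraic_one.add (b.2.1.mul a.2.1)).inv
          set d : {x : ℝ // IsAlgebraic ℚ x ∧ 0 < x ∧ x < 1} :=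
            ⟨(a.1 - b.1) / (1 + b.1 * a.1), hdalg, hd0, hd1⟩ with hd
          have hmove : KZ.of (I a) - KZ.of (I b) - KZ.of (I d) ∈ KZ.relations :=
            as_sub_move b.2.1 a.2.1 b.2.2.1.le hgt (I b) (I a) (I d) (hI b) (hI a) (hI d)
          have hθ : Real.arctan d.1 = Real.arctan a.1 - Real.arctan b.1 :=
            as_arctan_sub b.2.2.1.le a.2.2.1.le
          have hrec := ih (d :: L₁') L₂' (by simp only [List.length_cons]; omega) (by
            simp only [List.map_cons, List.sum_cons, hθ]
            linarith)
          simp only [List.map_cons, List.sum_cons] at hrec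
          have e : KZ.of (I a) + (L₁'.map fun t => KZ.of (I t)).sum -
              (KZ.of (I b) + (L₂'.map fun t => KZ.of (I t)).sum) =
              (KZ.of (I d) + (L₁'.map fun t => KZ.of (I t)).sum - (L₂'.map fun t => KZ.of (I t)).sum) +
                (KZ.of (I a) - KZ.of (I b) - KZ.of (I d)) := by abel
          rw [e]
          exact add_mem hrec hmove

/-! ## Bookkeeping: integer combinations as differences of list sums -/

/-- Sum of a map over a `flatMap` of replicated entries. [folklore] -/
theorem as_sum_map_flatMap_replicate {ι α M : Type*} [AddCommMonoid M] (l : List ι) (m : ι → ℕ)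
    (t : ι → α) (f : α → M) :
    ((l.flatMap fun i => List.replicate (m i) (t i)).map f).sum = (l.map fun i => m i • f (t i)).sum := by
  induction l with
  | nil => simp
  | cons i l ih =>
    simp only [List.flatMap_cons, List.map_append, List.sum_append, ih, List.map_cons, List.sum_cons,
      List.map_replicate, List.sum_replicate]

/-! ## The stub -/

/-- **S7 (arc scissors on the rational circle).** An INTEGER combination of standard arcs
`[(0, x_k), du/(1+u²)]` (`x_k ∈ (0,1)` real algebraic) of total angle `Σ n_k arctan x_k = 0` is a
relation: two tilings of the same total angle by the positive and the negative arcs have a common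
refinement, reached by cuts (rule 1a) and Möbius rotations `u ↦ (u − x)/(1 + xu)` (rule 2), after which
the pieces cancel formally. [cite: KontsevichZagier2001, §1.2] -/
theorem stub_arcScissors : ∀ (K : ℕ) (x : Fin K → ℝ) (n : Fin K → ℤ) (σ : Fin K → KZ.IntegralRep 1),
    (∀ k, IsAlgebraic ℚ (x k) ∧ 0 < x k ∧ x k < 1) →
    ∑ k, (n k : ℝ) * Real.arctan (x k) = 0 →
    (∀ k, (σ k).domain = {y | y 0 ∈ Set.Ioo 0 (x k)} ∧
      Set.EqOn (σ k).integrand (fun y => 1 / (1 + (y 0) ^ 2)) (σ k).domain) →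
    ∑ k, n k • KZ.of (σ k) ∈ KZ.relations := by
  intro K x n σ hx hrel hσ
  classical
  -- a chosen family of standard arc representations
  have hex : ∀ t : {x : ℝ // IsAlgebraic ℚ x ∧ 0 < x ∧ x < 1}, ∃ r : KZ.IntegralRep 1,
      r.domain = {y | y 0 ∈ Set.Ioo 0 t.1} ∧ r.integrand = fun y => 1 / (1 + (y 0) ^ 2) :=
    fun t => as_exists_arcRep isAlgebraic_zero t.2.1
  choose I hI using hex
  set t : Fin K → {x : ℝ // IsAlgebraic ℚ x ∧ 0 < x ∧ x < 1} := fun k => ⟨x k, hx k⟩ with ht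
  -- replace the given `σ k` by the chosen representations (rule 1b)
  have hrepl : ∀ k, KZ.of (σ k) - KZ.of (I (t k)) ∈ KZ.relations := fun k =>
    KZ.of_sub_of_mem_relations_of_eqOn (by rw [(hI _).1, (hσ k).1]) fun y hy => by
      rw [(hI _).2]
      exact (hσ k).2 hy
  -- the positive and the negative lists
  set L₁ := (List.finRange K).flatMap fun k => List.replicate (n k).toNat (t k) with hL₁
  set L₂ := (List.finRange K).flatMap fun k => List.replicate (-n k).toNat (t k) with hL₂
  have hθ : (L₁.map fun t => Real.arctan t.1).sum = (L₂.map fun t => Real.arctan t.1).sum := by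
    rw [hL₁, hL₂, as_sum_map_flatMap_replicate, as_sum_map_flatMap_replicate, ← Fin.sum_univ_def,
      ← Fin.sum_univ_def]
    simp only [nsmul_eq_mul]
    rw [← sub_eq_zero, ← Finset.sum_sub_distrib]
    have e : ∑ k, ((((n k).toNat : ℕ) : ℝ) * Real.arctan (t k).1 -
        (((-n k).toNat : ℕ) : ℝ) * Real.arctan (t k).1) = ∑ k, (n k : ℝ) * Real.arctan (x k) := by
      refine Finset.sum_congr rfl fun k _ => ?_
      rw [← sub_mul]
      congr 1
      have := Int.toNat_sub_toNat_neg (n k)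
      exact_mod_cast this
    rw [e, hrel]
  have key := as_list_cancel I hI (L₁.length + L₂.length) L₁ L₂ le_rfl hθ
  rw [hL₁, hL₂, as_sum_map_flatMap_replicate, as_sum_map_flatMap_replicate, ← Fin.sum_univ_def,
    ← Fin.sum_univ_def, ← Finset.sum_sub_distrib] at key
  -- `n • [σ k] = n⁺ • [I k] − n⁻ • [I k] + n • ([σ k] − [I k])`
  have e : ∑ k, n k • KZ.of (σ k) =
      ∑ k, ((n k).toNat • KZ.of (I (t k)) - (-n k).toNat • KZ.of (I (t k))) +
        ∑ k, n k • (KZ.of (σ k) - KZ.of (I (t k))) := by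
    rw [← Finset.sum_add_distrib]
    refine Finset.sum_congr rfl fun k _ => ?_
    have hn : n k = ((n k).toNat : ℤ) - ((-n k).toNat : ℤ) := (Int.toNat_sub_toNat_neg (n k)).symm
    have hsplit : ∀ v : KZ.FormalRep, n k • v = (n k).toNat • v - (-n k).toNat • v := fun v => by
      conv_lhs => rw [hn]
      rw [sub_smul, natCast_zsmul, natCast_zsmul]
    rw [smul_sub, hsplit, hsplit]
    abel
  rw [e]
  exact add_mem key (sum_mem fun k _ => KZ.relations.zsmul_mem (hrepl k) _)

end Summit.KontsevichZagierPeriods.InverseLandau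

end
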